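import Summits.Ventures.PercRepro.RankLevelSetLevelSixT23Cell10A
import Summits.Ventures.PercRepro.RankLevelSetLevelSixT23Cell10B
import Summits.Ventures.PercRepro.S2CoreSeventeenSplit
import Summits.Ventures.PercRepro.RankLevelSetCoreSixColoopFree
import Summits.Ventures.PercRepro.S3SixWindow

/-!
# PercRepro — THE 23 ROW, CORANK 10, PART C: THE CORE CELL (23, 10) BY THE 5-LEVEL COLOOP SPLIT (p8 g11, S3)

`proofs/SUBCLAIM-S3-p8.md` §3y. Every `e`-free core of rank `23`, corank `10`, is coloop-free (the honest cell) or has a coloop `e`, and `M ∖ e` is a core of rank `22`, corank `10`, on which the scaled statement `(Φ(23, 6)/2)·#U ≤ #Y` suffices (`RLS_of_coloop_scaled`, `weighted_of_isColoop_scaled`); the split repeats 5 times down to the every-core terminal at rank `18` (`Φ(23, 6)/32`). Axioms: standard.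
-/

open scoped Matroid

namespace PercRepro

namespace ThmN

open Set

variable {α : Type}

-- ===== RankLevelSetLevelSixT23Split10 =====


/-- **The 5-times scaled cell on EVERY `e`-free core of rank `18`, corank `10`.** -/
theorem c025_core_six_t23_scaled5_all10 (M : Matroid α) [M.Finite]
    (hR : M.eRank = (18 : ℕ∞)) (hn : M.E.ncard = 18 + 10)
    (hfree : ∀ e ∈ M.E, ∃ A ⊆ M.E \ {e}, e ∉ M.closure A ∧ e ∉ M.closure ((M.E \ {e}) \ A)) :
    phiK (18 + 5) 6 / 32 * (Matroid.topCount M 18 6 : ℚ) ≤ (Matroid.midCount M 18 6 : ℚ) := by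
  exact c025_core_six_t23_scaled5_every10 M 18 (le_refl 18) hR hn hfree

/-- **The 4-times scaled cell on EVERY `e`-free core of rank `19`, corank `10`.** -/
theorem c025_core_six_t23_scaled4_all10 (M : Matroid α) [M.Finite]
    (hR : M.eRank = (19 : ℕ∞)) (hn : M.E.ncard = 19 + 10)
    (hfree : ∀ e ∈ M.E, ∃ A ⊆ M.E \ {e}, e ∉ M.closure A ∧ e ∉ M.closure ((M.E \ {e}) \ A)) :
    phiK (19 + 4) 6 / 16 * (Matroid.topCount M 19 6 : ℚ) ≤ (Matroid.midCount M 19 6 : ℚ) := by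
  by_cases hc : ∃ e ∈ M.E, M.IsColoop e
  · obtain ⟨e, _, hce⟩ := hc
    have hR' : M.eRank = ((18 + 1 : ℕ) : ℕ∞) := by rw [hR]; norm_num
    obtain ⟨hn18, hR18, hfree18, -⟩ := delete_core_data M hce hR' (by omega) hfree
    have h := c025_core_six_t23_scaled5_every10 (M ＼ {e}) 18 (le_refl 18) hR18 hn18 hfree18
    have h' : phiK (19 + 4) 6 / 16 / 2 * (Matroid.topCount (M ＼ {e}) 18 6 : ℚ) ≤
        (Matroid.midCount (M ＼ {e}) 18 6 : ℚ) := by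
      have e1 : phiK (19 + 4) 6 / 16 / 2 = phiK (18 + 5) 6 / 32 := by
        rw [show (19 + 4 : ℕ) = 18 + 5 by norm_num]; ring
      rw [e1]; exact h
    exact weighted_of_isColoop_scaled M hce (by norm_num) hR' (phiK (19 + 4) 6 / 16) h'
  · exact c025_core_six_t23_scaled4_cf10 M 19 (le_refl 19) (fun e he hce => hc ⟨e, he, hce⟩) hR hn hfree

/-- **The 3-times scaled cell on EVERY `e`-free core of rank `20`, corank `10`.** -/
theorem c025_core_six_t23_scaled3_all10 (M : Matroid α) [M.Finite]
    (hR : M.eRank = (20 : ℕ∞)) (hn : M.E.ncard = 20 + 10)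
    (hfree : ∀ e ∈ M.E, ∃ A ⊆ M.E \ {e}, e ∉ M.closure A ∧ e ∉ M.closure ((M.E \ {e}) \ A)) :
    phiK (20 + 3) 6 / 8 * (Matroid.topCount M 20 6 : ℚ) ≤ (Matroid.midCount M 20 6 : ℚ) := by
  by_cases hc : ∃ e ∈ M.E, M.IsColoop e
  · obtain ⟨e, _, hce⟩ := hc
    have hR' : M.eRank = ((19 + 1 : ℕ) : ℕ∞) := by rw [hR]; norm_num
    obtain ⟨hn19, hR19, hfree19, -⟩ := delete_core_data M hce hR' (by omega) hfree
    have h := c025_core_six_t23_scaled4_all10 (M ＼ {e}) hR19 hn19 hfree19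
    have h' : phiK (20 + 3) 6 / 8 / 2 * (Matroid.topCount (M ＼ {e}) 19 6 : ℚ) ≤
        (Matroid.midCount (M ＼ {e}) 19 6 : ℚ) := by
      have e1 : phiK (20 + 3) 6 / 8 / 2 = phiK (19 + 4) 6 / 16 := by
        rw [show (20 + 3 : ℕ) = 19 + 4 by norm_num]; ring
      rw [e1]; exact h
    exact weighted_of_isColoop_scaled M hce (by norm_num) hR' (phiK (20 + 3) 6 / 8) h'
  · exact c025_core_six_t23_scaled3_cf10 M 20 (le_refl 20) (fun e he hce => hc ⟨e, he, hce⟩) hR hn hfree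

/-- **The 2-times scaled cell on EVERY `e`-free core of rank `21`, corank `10`.** -/
theorem c025_core_six_t23_scaled2_all10 (M : Matroid α) [M.Finite]
    (hR : M.eRank = (21 : ℕ∞)) (hn : M.E.ncard = 21 + 10)
    (hfree : ∀ e ∈ M.E, ∃ A ⊆ M.E \ {e}, e ∉ M.closure A ∧ e ∉ M.closure ((M.E \ {e}) \ A)) :
    phiK (21 + 2) 6 / 4 * (Matroid.topCount M 21 6 : ℚ) ≤ (Matroid.midCount M 21 6 : ℚ) := by
  by_cases hc : ∃ e ∈ M.E, M.IsColoop e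
  · obtain ⟨e, _, hce⟩ := hc
    have hR' : M.eRank = ((20 + 1 : ℕ) : ℕ∞) := by rw [hR]; norm_num
    obtain ⟨hn20, hR20, hfree20, -⟩ := delete_core_data M hce hR' (by omega) hfree
    have h := c025_core_six_t23_scaled3_all10 (M ＼ {e}) hR20 hn20 hfree20
    have h' : phiK (21 + 2) 6 / 4 / 2 * (Matroid.topCount (M ＼ {e}) 20 6 : ℚ) ≤
        (Matroid.midCount (M ＼ {e}) 20 6 : ℚ) := by
      have e1 : phiK (21 + 2) 6 / 4 / 2 = phiK (20 + 3) 6 / 8 := by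
        rw [show (21 + 2 : ℕ) = 20 + 3 by norm_num]; ring
      rw [e1]; exact h
    exact weighted_of_isColoop_scaled M hce (by norm_num) hR' (phiK (21 + 2) 6 / 4) h'
  · exact c025_core_six_t23_scaled2_cf10 M 21 (le_refl 21) (fun e he hce => hc ⟨e, he, hce⟩) hR hn hfree

/-- **The 1-times scaled cell on EVERY `e`-free core of rank `22`, corank `10`.** -/
theorem c025_core_six_t23_scaled1_all10 (M : Matroid α) [M.Finite]
    (hR : M.eRank = (22 : ℕ∞)) (hn : M.E.ncard = 22 + 10)
    (hfree : ∀ e ∈ M.E, ∃ A ⊆ M.E \ {e}, e ∉ M.closure A ∧ e ∉ M.closure ((M.E \ {e}) \ A)) :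
    phiK (22 + 1) 6 / 2 * (Matroid.topCount M 22 6 : ℚ) ≤ (Matroid.midCount M 22 6 : ℚ) := by
  by_cases hc : ∃ e ∈ M.E, M.IsColoop e
  · obtain ⟨e, _, hce⟩ := hc
    have hR' : M.eRank = ((21 + 1 : ℕ) : ℕ∞) := by rw [hR]; norm_num
    obtain ⟨hn21, hR21, hfree21, -⟩ := delete_core_data M hce hR' (by omega) hfree
    have h := c025_core_six_t23_scaled2_all10 (M ＼ {e}) hR21 hn21 hfree21
    have h' : phiK (22 + 1) 6 / 2 / 2 * (Matroid.topCount (M ＼ {e}) 21 6 : ℚ) ≤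
        (Matroid.midCount (M ＼ {e}) 21 6 : ℚ) := by
      have e1 : phiK (22 + 1) 6 / 2 / 2 = phiK (21 + 2) 6 / 4 := by
        rw [show (22 + 1 : ℕ) = 21 + 2 by norm_num]; ring
      rw [e1]; exact h
    exact weighted_of_isColoop_scaled M hce (by norm_num) hR' (phiK (22 + 1) 6 / 2) h'
  · exact c025_core_six_t23_scaled1_cf10 M 22 (le_refl 22) (fun e he hce => hc ⟨e, he, hce⟩) hR hn hfree

/-- **The core cell `(23, 10)`, every `e`-free core.** -/
theorem c025_core_six_twentythree_10 (M : Matroid α) [M.Finite]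
    (hR : M.eRank = (23 : ℕ∞)) (hn : M.E.ncard = 23 + 10)
    (hfree : ∀ e ∈ M.E, ∃ A ⊆ M.E \ {e}, e ∉ M.closure A ∧ e ∉ M.closure ((M.E \ {e}) \ A)) :
    RLS M 23 6 := by
  by_cases hc : ∃ e ∈ M.E, M.IsColoop e
  · obtain ⟨e, _, hce⟩ := hc
    have hR' : M.eRank = ((22 + 1 : ℕ) : ℕ∞) := by rw [hR]; norm_num
    obtain ⟨hn22, hR22, hfree22, -⟩ := delete_core_data M hce hR' (by omega) hfree
    exact RLS_of_coloop_scaled M hce (by norm_num) hR'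
      (c025_core_six_t23_scaled1_all10 (M ＼ {e}) hR22 hn22 hfree22)
  · exact c025_core_six_t23_free10 M 23 (le_refl 23) (fun e he hce => hc ⟨e, he, hce⟩) hR hn hfree

end ThmN

end PercRepro
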